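import Literature.Probability.Distributions.ExtendedPoisson
import Mathlib.Probability.Independence.Basic
import Mathlib.MeasureTheory.MeasurableSpace.NCard
import Mathlib.Data.Set.Card.Arithmetic
import HarnessLib

/-!
# Kingman's Countable Additivity Theorem for Poisson variables

J. F. C. Kingman, *Poisson Processes* (Oxford, 1993), §1.2, p. 5:

> **Countable Additivity Theorem.** Let `X_j` (`j = 1, 2, …`) be independent random variables,
> and assume that `X_j` has the distribution `𝒫(μ_j)` for each `j`. If `σ = Σ μ_j` converges, then
> `S = Σ X_j` converges with probability 1, and `S` has distribution `𝒫(σ)`. If on the other hand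
> `Σ μ_j` diverges, then `S` diverges with probability 1.

With Kingman's conventions `𝒫(0) = δ₀`, `𝒫(∞) = δ_∞` (`extPoissonMeasure`, file
`ExtendedPoisson`) both cases read: `S ~ 𝒫(Σ μ_j)`. We state the theorem for a countable index
set `ι` and in the form in which it is used for point processes (Kingman §2.2, (2.21):
`N(A) = Σₙ Nₙ(A)`): the sum `S` is the number of points `#D` (`Set.encard`, valued in `ℕ∞`) of a
random countable set `D ⊆ ι × ℕ` whose slices `{r | (i, r) ∈ D}` have independent Poisson
cardinalities `X_i`. The proof is Kingman's: the partial sums over finite `F ⊆ ι` are Poisson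
(Mathlib's `IndepFun.hasLaw_add_poissonMeasure`), the events `{S_F ≤ k}` decrease to `{S ≤ k}`,
and `Σ_{j≤k} π_j(σ_F) → Σ_{j≤k} π_j(σ)` (continuity), resp. `→ 0` if `σ_F → ∞`.
-/

noncomputable section

open MeasureTheory ProbabilityTheory Set Filter
open scoped ENNReal NNReal Topology

namespace Literature.Probability.Distributions

variable {ι : Type*}

/-- The number of points of `D ⊆ ι × ℕ` above a finite set `F` of indices is the sum of the
cardinalities of the slices `{r | (i, r) ∈ D}`, `i ∈ F`. [folklore] -/
theorem encard_inter_prod_univ (D : Set (ι × ℕ)) (F : Finset ι) :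
    (D ∩ (↑F ×ˢ univ)).encard = ∑ i ∈ F, (Prod.mk i ⁻¹' D).encard := by
  have hU : D ∩ (↑F ×ˢ univ) = ⋃ i ∈ (F : Set ι), Prod.mk i '' (Prod.mk i ⁻¹' D) := by
    ext ⟨i, r⟩
    simp only [mem_inter_iff, mem_prod, Finset.mem_coe, mem_univ, and_true, mem_iUnion,
      mem_image, mem_preimage, Prod.mk.injEq, exists_prop]
    constructor
    · rintro ⟨hD, hi⟩
      exact ⟨i, hi, r, hD, rfl, rfl⟩
    · rintro ⟨j, hj, r', hD, rfl, rfl⟩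
      exact ⟨hD, hj⟩
  rw [hU, Set.Finite.encard_biUnion F.finite_toSet, finsum_mem_coe_finset]
  · exact Finset.sum_congr rfl fun i _ ↦ (Prod.mk_right_injective i).encard_image _
  · exact fun i _ j _ hij ↦ disjoint_image_image fun r _ r' _ h ↦ hij (congrArg Prod.fst h)

/-- The number of points of `D ⊆ ι × ℕ` is the supremum over finite `F ⊆ ι` of the number of
points above `F` (a set with more than `k` points has `k + 1` of them above finitely many
indices). [folklore] -/
theorem encard_eq_iSup_encard_inter_prod_univ (D : Set (ι × ℕ)) :
    D.encard = ⨆ F : Finset ι, (D ∩ (↑F ×ˢ univ)).encard := by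
  classical
  refine le_antisymm ?_ (iSup_le fun F ↦ encard_le_encard inter_subset_left)
  rcases D.finite_or_infinite with hD | hD
  · have hsub : D ⊆ D ∩ (↑(hD.image Prod.fst).toFinset ×ˢ univ) :=
      fun p hp ↦ ⟨hp, by simpa using mem_image_of_mem Prod.fst hp, mem_univ _⟩
    exact (encard_le_encard hsub).trans
      (le_iSup (fun F : Finset ι ↦ (D ∩ (↑F ×ˢ univ)).encard) (hD.image Prod.fst).toFinset)
  · rw [hD.encard_eq, top_le_iff]
    refine iSup_eq_top.2 fun b hb ↦ ?_
    obtain ⟨k, rfl⟩ := ENat.ne_top_iff_exists.1 hb.ne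
    obtain ⟨t, htD, htfin, htk⟩ := hD.exists_subset_ncard_eq (k + 1)
    refine ⟨(htfin.image Prod.fst).toFinset, ?_⟩
    have hsub : t ⊆ D ∩ (↑(htfin.image Prod.fst).toFinset ×ˢ univ) :=
      fun p hp ↦ ⟨htD hp, by simpa using mem_image_of_mem Prod.fst hp, mem_univ _⟩
    calc (k : ℕ∞) < ((k + 1 : ℕ) : ℕ∞) := by exact_mod_cast k.lt_succ_self
      _ = t.encard := by rw [← htfin.cast_ncard_eq, htk]
      _ ≤ _ := encard_le_encard hsub

/-- `#D = sup_F Σ_{i ∈ F} #{r | (i, r) ∈ D}` for `D ⊆ ι × ℕ`: the countable sum of the slice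
cardinalities, written as a supremum of finite partial sums in `ℕ∞`. [folklore] -/
theorem encard_eq_iSup_sum_encard_preimage_mk (D : Set (ι × ℕ)) :
    D.encard = ⨆ F : Finset ι, ∑ i ∈ F, (Prod.mk i ⁻¹' D).encard := by
  rw [encard_eq_iSup_encard_inter_prod_univ]
  exact iSup_congr fun F ↦ encard_inter_prod_univ D F

variable {Ω : Type*} [MeasurableSpace Ω] {P : Measure Ω}

/-- Finite additivity: a finite sum of independent Poisson variables `X_i ~ 𝒫(a_i)` is
`𝒫(Σ_{i∈F} a_i)` ("this extends by induction to the sum of any finite number of independent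
random variables"). [cite: Kingman1993, §1.2, p. 5] -/
theorem hasLaw_finsetSum_poissonMeasure [DecidableEq ι] {T : ι → Ω → ℕ} {a : ι → ℝ≥0}
    (hT : ∀ i, Measurable (T i)) (hlaw : ∀ i, HasLaw (T i) (poissonMeasure (a i)) P)
    (hind : iIndepFun T P) (F : Finset ι) :
    HasLaw (fun ω ↦ ∑ i ∈ F, T i ω) (poissonMeasure (∑ i ∈ F, a i)) P := by
  have := hind.isProbabilityMeasure
  induction F using Finset.induction_on with
  | empty =>
    simp only [Finset.sum_empty]
    rw [poissonMeasure_zero]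
    exact hasLaw_dirac_of_ae_eq (ae_of_all _ fun _ ↦ rfl)
  | insert i F hi ih =>
    have hind' : IndepFun (∑ j ∈ F, T j) (T i) P := hind.indepFun_finsetSum_of_notMem hT hi
    have hF : HasLaw (∑ j ∈ F, T j) (poissonMeasure (∑ j ∈ F, a j)) P := by
      convert ih using 1
      ext ω
      simp [Finset.sum_apply]
    have h := hind'.hasLaw_add_poissonMeasure hF (hlaw i)
    simp only [Finset.sum_insert hi]
    rw [add_comm (a i)]
    convert h using 1
    ext ω
    simp [Finset.sum_apply, add_comm]

/-- **Kingman's Countable Additivity Theorem** (random countable set form). Let `D ⊆ ι × ℕ` be a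
random set (`ι` countable; the events `{(i, r) ∈ D}` measurable) whose slices
`{r | (i, r) ∈ D}` have cardinalities `X_i` that are independent with `X_i ~ 𝒫(a_i)`. Then the
number of points `#D = Σ_i X_i ∈ ℕ∞` has Kingman's law `𝒫(Σ_i a_i)`: Poisson if `Σ a_i < ∞`, and
`#D = ∞` almost surely if `Σ a_i = ∞`. [cite: Kingman1993, §1.2 Countable Additivity Theorem, p. 5] -/
theorem hasLaw_encard_extPoissonMeasure [Countable ι] {A : Ω → Set (ι × ℕ)} {T : ι → Ω → ℕ}
    {a : ι → ℝ≥0} (hA : ∀ p, MeasurableSet {ω | p ∈ A ω}) (hT : ∀ i, Measurable (T i))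
    (hfib : ∀ i ω, (Prod.mk i ⁻¹' A ω).encard = T i ω)
    (hlaw : ∀ i, HasLaw (T i) (poissonMeasure (a i)) P) (hind : iIndepFun T P) :
    HasLaw (fun ω ↦ (A ω).encard) (extPoissonMeasure (∑' i, (a i : ℝ≥0∞))) P := by
  have hP : IsProbabilityMeasure P := hind.isProbabilityMeasure
  classical
  set σ : ℝ≥0∞ := ∑' i, (a i : ℝ≥0∞) with hσ
  -- partial sums over finite sets of indices are Poisson
  set S : Finset ι → Ω → ℕ := fun F ω ↦ ∑ i ∈ F, T i ω with hS
  have hSmeas : ∀ F, Measurable (S F) := fun F ↦ Finset.measurable_sum F fun i _ ↦ hT i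
  have hSlaw : ∀ F : Finset ι, HasLaw (S F) (poissonMeasure (∑ i ∈ F, a i)) P :=
    hasLaw_finsetSum_poissonMeasure hT hlaw hind
  -- `#A = sup_F S_F`
  have hsup : ∀ ω, (A ω).encard = ⨆ F : Finset ι, (S F ω : ℕ∞) := fun ω ↦ by
    rw [encard_eq_iSup_sum_encard_preimage_mk]
    refine iSup_congr fun F ↦ ?_
    simp only [hS, hfib, Nat.cast_sum]
  -- the events `{#A ≤ k}` are the decreasing intersections of the events `{S_F ≤ k}`
  have hev : ∀ k : ℕ, {ω | (A ω).encard ≤ k} = ⋂ F : Finset ι, {ω | S F ω ≤ k} := fun k ↦ by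
    ext ω
    simp only [mem_setOf_eq, hsup, iSup_le_iff, mem_iInter, Nat.cast_le]
  have hlim : ∀ k : ℕ, Tendsto (fun F : Finset ι ↦ P {ω | S F ω ≤ k}) atTop
      (𝓝 (P {ω | (A ω).encard ≤ k})) := fun k ↦ by
    rw [hev]
    exact tendsto_measure_iInter_atTop
      (fun F ↦ (measurableSet_le (hSmeas F) measurable_const).nullMeasurableSet)
      (fun F G hFG ω (hω : S G ω ≤ k) ↦ (Finset.sum_le_sum_of_subset hFG).trans hω)
      ⟨∅, measure_ne_top _ _⟩
  -- `P{S_F ≤ k} = Σ_{j ≤ k} π_j(σ_F)`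
  have hval : ∀ (k : ℕ) (F : Finset ι),
      P {ω | S F ω ≤ k} = poissonMeasure (∑ i ∈ F, a i) (Iic k) := fun k F ↦
    (hSlaw F).measure_eq (p := fun n : ℕ ↦ n ≤ k) MeasurableSet.of_discrete
  -- `σ_F → σ`, hence `Σ_{j≤k} π_j(σ_F) → 𝒫(σ){· ≤ k}` (two cases: `σ < ∞`, `σ = ∞`)
  have hsum : Tendsto (fun F : Finset ι ↦ ((∑ i ∈ F, a i : ℝ≥0) : ℝ≥0∞)) atTop (𝓝 σ) := by
    simp_rw [ENNReal.ofNNReal_finsetSum]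
    exact ENNReal.summable.hasSum
  have hcdf : ∀ k : ℕ, Tendsto (fun F : Finset ι ↦ poissonMeasure (∑ i ∈ F, a i) (Iic k)) atTop
      (𝓝 (extPoissonMeasure σ (Iic (k : ℕ∞)))) := by
    intro k
    rcases eq_or_ne σ ∞ with htop | htop
    · rw [htop, extPoissonMeasure_top_Iic]
      rw [htop] at hsum
      exact (tendsto_poissonMeasure_Iic_atTop k).comp (ENNReal.tendsto_coe_nhds_top.1 hsum)
    · have h2 : Tendsto (fun F : Finset ι ↦ ∑ i ∈ F, a i) atTop (𝓝 σ.toNNReal) :=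
        ((ENNReal.tendsto_toNNReal htop).comp hsum).congr fun F ↦ by
          simp only [Function.comp_apply, ENNReal.toNNReal_coe]
      rw [← ENNReal.coe_toNNReal htop, extPoissonMeasure_coe_Iic]
      exact ((continuous_poissonMeasure_Iic k).tendsto _).comp h2
  have hIic : ∀ k : ℕ, P {ω | (A ω).encard ≤ k} = extPoissonMeasure σ (Iic (k : ℕ∞)) :=
    fun k ↦ tendsto_nhds_unique (hlim k) (by simp_rw [hval k]; exact hcdf k)
  -- conclusion: the two probability laws on `ℕ∞` have the same distribution function on `ℕ`
  have hmeasA : Measurable A := measurable_set_iff.2 fun p ↦ measurableSet_setOf.1 (hA p)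
  have hmeas : Measurable fun ω ↦ (A ω).encard := measurable_encard.comp hmeasA
  refine ⟨hmeas.aemeasurable, ?_⟩
  have : IsProbabilityMeasure (P.map fun ω ↦ (A ω).encard) :=
    Measure.isProbabilityMeasure_map hmeas.aemeasurable
  refine measure_eq_of_Iic fun k ↦ ?_
  rw [Measure.map_apply hmeas MeasurableSet.of_discrete, ← hIic k]
  rfl

end Literature.Probability.Distributions
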